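import Summits.BirchSwinnertonDyer.BirchSwinnertonDyer.Theorems.PrintCf2SplitBadTwoCMPrimaryDyadicTableStrict
import Summits.BirchSwinnertonDyer.BirchSwinnertonDyer.Theorems.PrintCf2SplitBadTwoCMPrimaryDyadicValueFrame
import HarnessLib

/-!
# Crux `PrintCf2.SplitBadTwoRankOneOfFacts` (stmt-BirchSwinnertonDyer-20368), road α v10.3 — brick B15 file 14: THE DYADIC LOCAL FACTORS, ASSEMBLED —
# `v₂ #W*(K_v) = 1` and `v₂ #W*(K_{v̄}) = 1 + [d ≡ 3 (8)]` on every S3c frame, also in the `∃ e, … = e (d % 2) ((d / (2 − d % 2)) % 8)` shape of the cuts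

Cell `bsd-print-cf2`, width seat `bsd-line-cf2-p1-w2` g9 (prover-bsd-line-cf2-p1-w2-g9-0); brick B15 (memo `Cruxes/SplitBadTwoRankOneOfFacts/B15-DYADIC-EXACT-w2g9.md`
§1, §3); `--supports stmt-BirchSwinnertonDyer-20368` (helper, Theses-free). HONEST FRAMING: nothing here closes the crux or a registered stub; BSD is not
proved by any of this; no summit statement is proved by this seat. No definition, no named fact, no `sorry`. Assembly of files 4, 6, 7 (p662192, p663559,
p664023) — UNCONDITIONAL (no (C3-loc), no `κ'`).

WHAT. On every S3c frame (`d ≠ 0` squarefree, `d ≢ 1 (4)`, `C • W = cm7^{(d)}`, `K` imaginary quadratic, `2 = v·v̄`, `π² = π − 2`, `r² = r − 2`, pinning clause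
at `v` for `W* = E[𝔮_r^∞]`), the `2`-adic valuations of the local `H⁰` factors of the Euler-characteristic / bottom-value formula (Agboola Prop. 8.1, the
terms `#W*(K_𝔮)` at the two dyadic places):
* **`padicValNat_natCard_fixedPoints_decomp_v_of_frame`** — `v₂ #W*(K_v) = 1`;
* **`padicValNat_natCard_fixedPoints_decomp_vbar_of_frame`** — `v₂ #W*(K_{v̄}) = if d ≡ 3 (8) then 2 else 1`;
* **`exists_e_padicValNat_natCard_fixedPoints_dyadic_of_frame`** — both in the displayed `∃ e : ℤ → ℤ → ℤ` frame shape used by the S3c cuts ((F1)/(F3) of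
  -w7's `rBV_of_three_factor_values`, `hBV`/`hDy` of LEAD g12's `restrictedControl_two_of_residuals_noC1`), for consumers of the bottom value.
presearch: [Agboola2007] §6, Prop. 8.1; [Rubin1999] §3 Cor. 3.17 — held; no fact filed. beyond-print theorem: no.

References: [Agboola2007] §6, Prop. 8.1; [Rubin1999] §3 Lemma 3.6 (ii), Cor. 3.17.
-/

noncomputable section

open scoped Classical

set_option linter.dupNamespace false
set_option autoImplicit false

namespace Summit.BirchSwinnertonDyer.BirchSwinnertonDyer.Theorems.PrintCf2.CMPrimes

open WeierstrassCurve Literature.NumberTheory.EllipticCurves Literature.NumberTheory.GaloisRepresentations Field NumberField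
open IsDedekindDomain

variable {K : Type} [Field K] [NumberField K]

/-- **`v₂ #W*(K_v) = 1` on every S3c frame** (p663559 `natCard_fixedPoints_decomp_v_eq_two_of_frame`). [cite: Agboola2007, §6 and Prop. 8.1] -/
theorem padicValNat_natCard_fixedPoints_decomp_v_of_frame {d : ℤ} (hd0 : d ≠ 0) (hsq : Squarefree d) (hd4 : d % 4 ≠ 1)
    (W : WeierstrassCurve ℚ) [W.IsElliptic] (C : VariableChange ℚ) (hC : C • W = cm7.quadraticTwist (d : ℚ)) (hK : IsImaginaryQuadratic K)
    (v vbar : HeightOneSpectrum (𝓞 K)) (hv : ((2 : ℕ) : 𝓞 K) ∈ v.asIdeal) (hvbar : ((2 : ℕ) : 𝓞 K) ∈ vbar.asIdeal) (hne : vbar ≠ v)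
    (π : (W.baseChange K).endRing) (hrel : (π : AddMonoid.End (W.baseChange K).geomPoints) * π = π - 2) {r : ℤ_[2]} (hr : r * r = r - 2)
    (hclause : ∀ τ ∈ GreenbergSelmer.inertia v, ∀ x : ↥((W.baseChange K).endEigenPrimaryTorsion 2 π r), τ • x = x ∨ τ • x = -x) :
    padicValNat 2 (Nat.card (FixedPoints.addSubgroup (GreenbergSelmer.decomp v) ↥((W.baseChange K).endEigenPrimaryTorsion 2 π r))) = 1 := by
  haveI : Fact (Nat.Prime 2) := ⟨Nat.prime_two⟩
  rw [natCard_fixedPoints_decomp_v_eq_two_of_frame hd0 hsq hd4 W C hC hK v vbar hv hvbar hne π hrel hr hclause, padicValNat_self]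

/-- **`v₂ #W*(K_{v̄}) = 1 + [d ≡ 3 (8)]` on every S3c frame** (p664023 `= 4` for `d ≡ 3 (8)`, p662192 `= 2` otherwise). [cite: Agboola2007, §6 and Prop. 8.1]
[cite: Rubin1999, §3 Cor. 3.17] -/
theorem padicValNat_natCard_fixedPoints_decomp_vbar_of_frame {d : ℤ} (hd0 : d ≠ 0) (hsq : Squarefree d) (hd4 : d % 4 ≠ 1)
    (W : WeierstrassCurve ℚ) [W.IsElliptic] (C : VariableChange ℚ) (hC : C • W = cm7.quadraticTwist (d : ℚ)) (hK : IsImaginaryQuadratic K)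
    (v vbar : HeightOneSpectrum (𝓞 K)) (hv : ((2 : ℕ) : 𝓞 K) ∈ v.asIdeal) (hvbar : ((2 : ℕ) : 𝓞 K) ∈ vbar.asIdeal) (hne : vbar ≠ v)
    (π : (W.baseChange K).endRing) (hrel : (π : AddMonoid.End (W.baseChange K).geomPoints) * π = π - 2) {r : ℤ_[2]} (hr : r * r = r - 2)
    (hclause : ∀ τ ∈ GreenbergSelmer.inertia v, ∀ x : ↥((W.baseChange K).endEigenPrimaryTorsion 2 π r), τ • x = x ∨ τ • x = -x) :
    padicValNat 2 (Nat.card (FixedPoints.addSubgroup (GreenbergSelmer.decomp vbar) ↥((W.baseChange K).endEigenPrimaryTorsion 2 π r))) = if d % 8 = 3 then 2 else 1 := by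
  haveI : Fact (Nat.Prime 2) := ⟨Nat.prime_two⟩
  by_cases hd8 : d % 8 = 3
  · rw [natCard_fixedPoints_decomp_vbar_eq_four_of_frame hd0 hd8 W C hC hK v vbar hv hvbar hne π hrel hr hclause, if_pos hd8,
      show (4 : ℕ) = 2 ^ 2 by norm_num, padicValNat.prime_pow]
  · rw [natCard_fixedPoints_decomp_vbar_eq_two_of_frame hd0 hsq hd4 hd8 W C hC hK v vbar hv hvbar hne π hrel hr hclause, if_neg hd8,
      padicValNat_self]

omit [Field K] [NumberField K] in
/-- **The dyadic `H⁰` factors in the cuts' `∃ e` frame shape**: `v₂ #W*(K_v) = 1` and `v₂ #W*(K_{v̄}) = e (d % 2) ((d / (2 − d % 2)) % 8)` with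
`e (1) (3) = 2` and `e = 1` elsewhere. [cite: Agboola2007, §6 and Prop. 8.1] -/
theorem exists_e_padicValNat_natCard_fixedPoints_dyadic_of_frame :
    ∃ e : ℤ → ℤ → ℤ, ∀ (d : ℤ), d ≠ 0 → Squarefree d → d % 4 ≠ 1 →
      ∀ (W : WeierstrassCurve ℚ) [W.IsElliptic] (C : VariableChange ℚ), C • W = cm7.quadraticTwist (d : ℚ) →
      ∀ (L : Type) [Field L] [NumberField L], IsImaginaryQuadratic L →
      ∀ (v vbar : HeightOneSpectrum (𝓞 L)),
        ((2 : ℕ) : 𝓞 L) ∈ v.asIdeal → ((2 : ℕ) : 𝓞 L) ∈ vbar.asIdeal → vbar ≠ v →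
      ∀ (π : (W.baseChange L).endRing), (π : AddMonoid.End (W.baseChange L).geomPoints) * π = π - 2 →
      ∀ (r : ℤ_[2]), r * r = r - 2 →
        (∀ τ ∈ GreenbergSelmer.inertia v, ∀ x : ↥((W.baseChange L).endEigenPrimaryTorsion 2 π r), τ • x = x ∨ τ • x = -x) →
        (padicValNat 2 (Nat.card (FixedPoints.addSubgroup (GreenbergSelmer.decomp v) ↥((W.baseChange L).endEigenPrimaryTorsion 2 π r))) : ℤ) = 1 ∧
        (padicValNat 2 (Nat.card (FixedPoints.addSubgroup (GreenbergSelmer.decomp vbar) ↥((W.baseChange L).endEigenPrimaryTorsion 2 π r))) : ℤ) = e (d % 2) ((d / (2 - d % 2)) % 8) := by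
  refine ⟨fun i j ↦ if i = 1 ∧ j = 3 then 2 else 1, ?_⟩
  intro d hd0 hsq hd4 W _ C hC L _ _ hL v vbar hv hvbar hne π hrel r hr hclause
  refine ⟨by rw [padicValNat_natCard_fixedPoints_decomp_v_of_frame hd0 hsq hd4 W C hC hL v vbar hv hvbar hne π hrel hr hclause]; rfl, ?_⟩
  rw [padicValNat_natCard_fixedPoints_decomp_vbar_of_frame hd0 hsq hd4 W C hC hL v vbar hv hvbar hne π hrel hr hclause]
  rcases (by omega : d % 2 = 1 ∨ d % 2 = 0) with h | h
  · rw [h, show (2 : ℤ) - 1 = 1 by norm_num, Int.ediv_one]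
    show _ = if (1 : ℤ) = 1 ∧ d % 8 = 3 then (2 : ℤ) else 1
    by_cases hc : d % 8 = 3
    · rw [if_pos hc, if_pos ⟨rfl, hc⟩]; rfl
    · rw [if_neg hc, if_neg (fun h' ↦ hc h'.2)]; rfl
  · rw [h, sub_zero]
    show _ = if (0 : ℤ) = 1 ∧ d / 2 % 8 = 3 then (2 : ℤ) else 1
    rw [if_neg (by omega), if_neg (by omega)]; rfl

end Summit.BirchSwinnertonDyer.BirchSwinnertonDyer.Theorems.PrintCf2.CMPrimes

end
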